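import Summits.RiemannHypothesis.RiemannHypothesis.Theorems.SemilocalLogAtomsE
import HarnessLib

/-!
# Log-atom enclosures (H): the atoms `83`, `89` and the window ends `log 97`, `log 101`

Cell `rh-explicit` (HOME `run/shared/lean/pub/rh-explicit/`), seat cc-s2-4 gen10 (A4 lane, the Lean side).  Sequel of
`SemilocalLogAtoms{,B,C,D,E,F,G}.lean`: the rational enclosures `(lo, hi, wlo, whi)` of `log 83`, `log 89` and of the
weights `log 83/√83`, `log 89/√89` needed by the negative certificates of the walls `q = 89` (`S = {p ≤ 83}`, window
`b < (log 92)/2`) and `q = 97` (`S = {p ≤ 89}`, window `b < (log 101)/2`), the third and fourth walls beyond every measured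
one: `log 83` to 10 decimals from `83 = 84·(1 − 1/84)` and `log 89` to 11 decimals from `89 = 88·(1 + 1/88)`
(`Real.abs_log_sub_add_sum_range_le`, 7 terms, with `log 2` (d20), `log 3`, `log 7`, `log 11`), square roots by squaring;
plus the coarse lower bounds `5 log 2 + log 3 + 1/97 ≤ log 97` and `2 log 2 + 2 log 5 + 1/101 ≤ log 101`
(`Real.one_sub_inv_le_log_of_pos`) for the window ends / handoff clauses.  (`SemilocalLogAtomsF.lean` already has the
coarse `logEightyThreeLo = 4 log 3⁻ + 2/83`; the fine two-sided enclosure here is named `logEightyThreeLo11/Hi11`.)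

Folklore numerics throughout; nothing here bears on RH.
-/

set_option autoImplicit false
set_option linter.dupNamespace false  -- the mandated namespace repeats `RiemannHypothesis`

noncomputable section

namespace Summit.RiemannHypothesis.RiemannHypothesis.Theorems.SemilocalPolyWitness

open Real
open Literature.NumberTheory.LFunctions
open Literature.Analysis.SpecialFunctions.Real
open Summit.RiemannHypothesis.RiemannHypothesis.Theorems.MotivicDoor.SemilocalMarkov

/-! ### The atom `83` (`log 83` from `83 = 84·(1 − 1/84)`) -/

/-- `(4.41884060769) < log 83` (`Real.abs_log_sub_add_sum_range_le` at `x = 1/84`, 7 terms). -/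
theorem log_eightythree_gt : (4.41884060769 : ℝ) < Real.log 83 := by
  have t : |((1 : ℝ) / 84)| < 1 := by rw [abs_of_pos (by norm_num)]; norm_num
  have z := Real.abs_log_sub_add_sum_range_le t 7
  rw [abs_of_pos (by norm_num : (0 : ℝ) < 1 / 84)] at z
  norm_num [Finset.sum_range_succ] at z
  have e : Real.log (83 / 84) = Real.log 83 - (2 * Real.log 2 + Real.log 3 + Real.log 7) := by
    rw [Real.log_div (by norm_num) (by norm_num), show (84 : ℝ) = 2 ^ 2 * 3 * 7 by norm_num,
      Real.log_mul (by norm_num) (by norm_num), Real.log_mul (by norm_num) (by norm_num), Real.log_pow]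
    push_cast; ring
  rw [e] at z
  have h2 := Literature.Analysis.SpecialFunctions.Real.log_two_gt_d20
  have h3 := logThreeLo_le
  rw [logThreeLo] at h3
  push_cast at h3
  have h7 := logSevenLo_le
  rw [logSevenLo] at h7
  push_cast at h7
  obtain ⟨z1, z2⟩ := abs_le.1 z
  linarith

/-- `log 83 < 4.41884060791` (`Real.abs_log_sub_add_sum_range_le` at `x = 1/84`, 7 terms). -/
theorem log_eightythree_lt : Real.log 83 < 4.41884060791 := by
  have t : |((1 : ℝ) / 84)| < 1 := by rw [abs_of_pos (by norm_num)]; norm_num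
  have z := Real.abs_log_sub_add_sum_range_le t 7
  rw [abs_of_pos (by norm_num : (0 : ℝ) < 1 / 84)] at z
  norm_num [Finset.sum_range_succ] at z
  have e : Real.log (83 / 84) = Real.log 83 - (2 * Real.log 2 + Real.log 3 + Real.log 7) := by
    rw [Real.log_div (by norm_num) (by norm_num), show (84 : ℝ) = 2 ^ 2 * 3 * 7 by norm_num,
      Real.log_mul (by norm_num) (by norm_num), Real.log_mul (by norm_num) (by norm_num), Real.log_pow]
    push_cast; ring
  rw [e] at z
  have h2 := Literature.Analysis.SpecialFunctions.Real.log_two_lt_d20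
  have h3 := log_three_le_logThreeHi
  rw [logThreeHi] at h3
  push_cast at h3
  have h7 := log_seven_le_logSevenHi
  rw [logSevenHi] at h7
  push_cast at h7
  obtain ⟨z1, z2⟩ := abs_le.1 z
  linarith

/-- lower decimal of `log 83` (fine; the coarse `logEightyThreeLo` lives in `SemilocalLogAtomsF.lean`) -/
def logEightyThreeLo11 : ℚ := 441884060769 / 100000000000
/-- upper decimal of `log 83` -/
def logEightyThreeHi11 : ℚ := 441884060791 / 100000000000
/-- `logEightyThreeLo11 ≤ log 83`. -/
theorem logEightyThreeLo11_le : (logEightyThreeLo11 : ℝ) ≤ Real.log 83 := by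
  rw [logEightyThreeLo11]; push_cast; linarith [log_eightythree_gt]
/-- `log 83 ≤ logEightyThreeHi11`. -/
theorem log_eightythree_le_logEightyThreeHi11 : Real.log 83 ≤ (logEightyThreeHi11 : ℝ) := by
  rw [logEightyThreeHi11]; push_cast; linarith [log_eightythree_lt]
/-- `9.1104335791442988 ≤ √83 ≤ 9.1104335791442989`. -/
def sqrtEightyThreeLo : ℚ := 91104335791442988 / 10000000000000000
/-- upper decimal of `√83` -/
def sqrtEightyThreeHi : ℚ := 91104335791442989 / 10000000000000000
/-- The atom `83`: weight `log 83/√83`. -/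
def atomEightyThree : ℕ × AtomQ :=
  (83, ⟨logEightyThreeLo11, logEightyThreeHi11, logEightyThreeLo11 / sqrtEightyThreeHi,
    logEightyThreeHi11 / sqrtEightyThreeLo⟩)
/-- `atomEightyThree` encloses the atom `83` for any `S ∋ 83`. -/
theorem atomEightyThree_encl {S : Finset ℕ} (h : 83 ∈ S) :
    (atomEightyThree.2.lo : ℝ) ≤ Real.log atomEightyThree.1 ∧ Real.log atomEightyThree.1 ≤ (atomEightyThree.2.hi : ℝ) ∧
      (atomEightyThree.2.wlo : ℝ) ≤ weilSemilocalCoeff S atomEightyThree.1 ∧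
      weilSemilocalCoeff S atomEightyThree.1 ≤ (atomEightyThree.2.whi : ℝ) := by
  simp only [atomEightyThree]
  push_cast
  have h0 := prime_atom_encl (by norm_num : Nat.Prime 83) h (lo := logEightyThreeLo11) (hi := logEightyThreeHi11)
    (slo := sqrtEightyThreeLo) (shi := sqrtEightyThreeHi) (by exact_mod_cast logEightyThreeLo11_le)
    (by exact_mod_cast log_eightythree_le_logEightyThreeHi11) (by rw [logEightyThreeLo11]; norm_num)
    (ratCast_le_sqrt (by rw [sqrtEightyThreeLo]; norm_num) (by rw [sqrtEightyThreeLo]; norm_num))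
    (sqrt_le_ratCast (by rw [sqrtEightyThreeHi]; norm_num) (by rw [sqrtEightyThreeHi]; norm_num))
    (by rw [sqrtEightyThreeLo]; norm_num)
  push_cast at h0
  exact h0

/-! ### The atom `89` (`log 89` from `89 = 88·(1 + 1/88)`) -/

/-- `(4.48863636972) < log 89` (`Real.abs_log_sub_add_sum_range_le` at `x = -1/88`, 7 terms). -/
theorem log_eightynine_gt : (4.48863636972 : ℝ) < Real.log 89 := by
  have t : |(-(1 : ℝ) / 88)| < 1 := by rw [abs_of_neg (by norm_num)]; norm_num
  have z := Real.abs_log_sub_add_sum_range_le t 7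
  rw [show |(-(1 : ℝ) / 88)| = 1 / 88 by rw [abs_of_neg (by norm_num)]; norm_num] at z
  norm_num [Finset.sum_range_succ] at z
  have e : Real.log (89 / 88) = Real.log 89 - (3 * Real.log 2 + Real.log 11) := by
    rw [Real.log_div (by norm_num) (by norm_num), show (88 : ℝ) = 2 ^ 3 * 11 by norm_num,
      Real.log_mul (by norm_num) (by norm_num), Real.log_pow]
    push_cast; ring
  rw [e] at z
  have h2 := Literature.Analysis.SpecialFunctions.Real.log_two_gt_d20
  have h11 := logElevenLo_le
  rw [logElevenLo] at h11
  push_cast at h11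
  obtain ⟨z1, z2⟩ := abs_le.1 z
  linarith

/-- `log 89 < 4.48863636974` (`Real.abs_log_sub_add_sum_range_le` at `x = -1/88`, 7 terms). -/
theorem log_eightynine_lt : Real.log 89 < 4.48863636974 := by
  have t : |(-(1 : ℝ) / 88)| < 1 := by rw [abs_of_neg (by norm_num)]; norm_num
  have z := Real.abs_log_sub_add_sum_range_le t 7
  rw [show |(-(1 : ℝ) / 88)| = 1 / 88 by rw [abs_of_neg (by norm_num)]; norm_num] at z
  norm_num [Finset.sum_range_succ] at z
  have e : Real.log (89 / 88) = Real.log 89 - (3 * Real.log 2 + Real.log 11) := by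
    rw [Real.log_div (by norm_num) (by norm_num), show (88 : ℝ) = 2 ^ 3 * 11 by norm_num,
      Real.log_mul (by norm_num) (by norm_num), Real.log_pow]
    push_cast; ring
  rw [e] at z
  have h2 := Literature.Analysis.SpecialFunctions.Real.log_two_lt_d20
  have h11 := log_eleven_le_logElevenHi
  rw [logElevenHi] at h11
  push_cast at h11
  obtain ⟨z1, z2⟩ := abs_le.1 z
  linarith

/-- lower decimal of `log 89` -/
def logEightyNineLo : ℚ := 448863636972 / 100000000000
/-- upper decimal of `log 89` -/
def logEightyNineHi : ℚ := 448863636974 / 100000000000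
/-- `logEightyNineLo ≤ log 89`. -/
theorem logEightyNineLo_le : (logEightyNineLo : ℝ) ≤ Real.log 89 := by
  rw [logEightyNineLo]; push_cast; linarith [log_eightynine_gt]
/-- `log 89 ≤ logEightyNineHi`. -/
theorem log_eightynine_le_logEightyNineHi : Real.log 89 ≤ (logEightyNineHi : ℝ) := by
  rw [logEightyNineHi]; push_cast; linarith [log_eightynine_lt]
/-- `9.4339811320566038 ≤ √89 ≤ 9.4339811320566039`. -/
def sqrtEightyNineLo : ℚ := 94339811320566038 / 10000000000000000
/-- upper decimal of `√89` -/
def sqrtEightyNineHi : ℚ := 94339811320566039 / 10000000000000000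
/-- The atom `89`: weight `log 89/√89`. -/
def atomEightyNine : ℕ × AtomQ :=
  (89, ⟨logEightyNineLo, logEightyNineHi, logEightyNineLo / sqrtEightyNineHi, logEightyNineHi / sqrtEightyNineLo⟩)
/-- `atomEightyNine` encloses the atom `89` for any `S ∋ 89`. -/
theorem atomEightyNine_encl {S : Finset ℕ} (h : 89 ∈ S) :
    (atomEightyNine.2.lo : ℝ) ≤ Real.log atomEightyNine.1 ∧ Real.log atomEightyNine.1 ≤ (atomEightyNine.2.hi : ℝ) ∧
      (atomEightyNine.2.wlo : ℝ) ≤ weilSemilocalCoeff S atomEightyNine.1 ∧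
      weilSemilocalCoeff S atomEightyNine.1 ≤ (atomEightyNine.2.whi : ℝ) := by
  simp only [atomEightyNine]
  push_cast
  have h0 := prime_atom_encl (by norm_num : Nat.Prime 89) h (lo := logEightyNineLo) (hi := logEightyNineHi)
    (slo := sqrtEightyNineLo) (shi := sqrtEightyNineHi) (by exact_mod_cast logEightyNineLo_le)
    (by exact_mod_cast log_eightynine_le_logEightyNineHi) (by rw [logEightyNineLo]; norm_num)
    (ratCast_le_sqrt (by rw [sqrtEightyNineLo]; norm_num) (by rw [sqrtEightyNineLo]; norm_num))
    (sqrt_le_ratCast (by rw [sqrtEightyNineHi]; norm_num) (by rw [sqrtEightyNineHi]; norm_num))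
    (by rw [sqrtEightyNineLo]; norm_num)
  push_cast at h0
  exact h0

/-! ### Lower bounds of `log 97` and `log 101` (window ends / handoff clauses of the walls `q = 89`, `q = 97`) -/

/-- `5 log 2⁻ + log 3⁻ + 1/97 ≤ log 97`: `log 97 = log 96 + log (97/96) ≥ 5 log 2 + log 3 + (1 − 96/97)`. -/
def logNinetySevenLo : ℚ := 5 * logTwoLo20 + logThreeLo + 1 / 97
/-- `logNinetySevenLo ≤ log 97`. -/
theorem logNinetySevenLo_le : (logNinetySevenLo : ℝ) ≤ Real.log 97 := by
  have h96 : Real.log 96 = 5 * Real.log 2 + Real.log 3 := by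
    rw [show (96 : ℝ) = 2 ^ 5 * 3 by norm_num, Real.log_mul (by norm_num) (by norm_num), Real.log_pow]; push_cast; ring
  have hq : Real.log 97 = 5 * Real.log 2 + Real.log 3 + Real.log (97 / 96) := by
    rw [← h96, ← Real.log_mul (by norm_num) (by norm_num)]
    norm_num
  have hlow : 1 - (97 / 96 : ℝ)⁻¹ ≤ Real.log (97 / 96) := Real.one_sub_inv_le_log_of_pos (by norm_num)
  have h2 := logTwoLo20_le
  have h3 := logThreeLo_le
  rw [logNinetySevenLo]
  push_cast
  rw [hq]
  norm_num at hlow ⊢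
  linarith

/-- `2 log 2⁻ + 2 log 5⁻ + 1/101 ≤ log 101`: `log 101 = log 100 + log (101/100) ≥ 2 log 2 + 2 log 5 + (1 − 100/101)`. -/
def logHundredOneLo : ℚ := 2 * logTwoLo20 + 2 * logFiveLo + 1 / 101
/-- `logHundredOneLo ≤ log 101`. -/
theorem logHundredOneLo_le : (logHundredOneLo : ℝ) ≤ Real.log 101 := by
  have h100 : Real.log 100 = 2 * Real.log 2 + 2 * Real.log 5 := by
    rw [show (100 : ℝ) = 2 ^ 2 * 5 ^ 2 by norm_num, Real.log_mul (by norm_num) (by norm_num), Real.log_pow, Real.log_pow]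
    push_cast; ring
  have hq : Real.log 101 = 2 * Real.log 2 + 2 * Real.log 5 + Real.log (101 / 100) := by
    rw [← h100, ← Real.log_mul (by norm_num) (by norm_num)]
    norm_num
  have hlow : 1 - (101 / 100 : ℝ)⁻¹ ≤ Real.log (101 / 100) := Real.one_sub_inv_le_log_of_pos (by norm_num)
  have h2 := logTwoLo20_le
  have h5 := logFiveLo_le
  rw [logHundredOneLo]
  push_cast
  rw [hq]
  norm_num at hlow ⊢
  linarith

/-! ## Appendix (cc-s2-4 gen11, 2026-08-24): users

Documentation only — no declaration is added or changed (this re-commit lets the hub build pick the module up: accepted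
2026-08-24T01:23Z inside the build worker's dead window, no olean at 07:50Z; OPS-REQUESTS l.215/l.221).

`atomEightyThree`, `atomEightyNine` (with `logEightyThreeLo11/Hi11`, `logEightyNineLo/Hi`) and the window-end bounds
`logNinetySevenLo`, `logHundredOneLo` serve the wall rows `SemilocalNegCertUptoEightyThree` (q = 89, S = {p ≤ 83}) and
`SemilocalNegCertUptoEightyNine` (q = 97, S = {p ≤ 89}) and every later wall (`…UptoHundredOne` … `…UptoHundredTwentySeven`,
q = 103 … 131; atoms `97 … 128` follow in `SemilocalLogAtomsI/J/K.lean`).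
-/

end Summit.RiemannHypothesis.RiemannHypothesis.Theorems.SemilocalPolyWitness

end
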